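import Literature.NumberTheory.LFunctions.SiegelWalfiszMoebius
import Literature.NumberTheory.LFunctions.LiouvilleSumClassicalBound
import HarnessLib

/-!
# Siegel–Walfisz for the Liouville function in arithmetic progressions

Topic `Literature/NumberTheory/LFunctions`.  Everything in this file is PROVED; the only input is
the named fact `Literature.NumberTheory.LFunctions.SiegelWalfiszMoebius` (Montgomery–Vaughan,
*Multiplicative Number Theory I*, §11.3 Exercise 13(f): `M(x; q, a) ≪_A x exp(−c√log x)` for
`q ≤ (log x)^A`, all residues `a`), from which we derive the Liouville analogue in the `(log x)^{-B}`
currency: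

* `SiegelWalfiszMoebius.liouville_progression` — for all `A > 0`, `B`, there is `C` with
  `|∑_{n ≤ x, n ≡ a (q)} λ(n)| ≤ C x/(log x)^B` for `x ≥ 2`, `1 ≤ q ≤ (log x)^A` and every residue
  `a (mod q)`.

This is the input "`max_c |∑_{n ≤ y, n ≡ c (q)} λ(n)| ≪_{A,K} y (log y)^{-2K}` by Siegel–Walfisz" of
Lichtman's Lemma 4.8 (arXiv:2009.08969, p. 12), towards the named fact
`Literature.NumberTheory.Sieve.Lichtman2020_siftedLiouvilleCharSum`.

## The argument

`λ = 𝟙_□ ⋆ μ` (the tree's `LiouvilleSum.coe_liouville_eq_zeta_mul_liouville_mul_moebius`), so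
`∑_{n ≤ N, n ≡ a} λ(n) = ∑_{s ≤ N, s = □} ∑_{m ≤ N/s, sm ≡ a (q)} μ(m)` (`sum_liouville_progression_eq`,
a Dirichlet rearrangement with the congruence carried along).  The inner sum is split according to
the residue of `m`: at most `q` classes `c` with `sc = a`, each bounded by Siegel–Walfisz for `μ`
(`abs_sum_filter_mul_le`), so it is `≤ q · C₁ (N/s)/(log(N/s))^{B₁}`; for `s = r² ≤ √N` this is
`≪ q N (log x)^{-B₁}/r²` (`log(N/s) ≥ (log x)/4`), and `∑ 1/r² ≤ 2`; the squares `s > √N` contribute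
trivially `≤ ∑_{r > N^{1/4}} N/r² ≤ 2 N^{3/4}`.  Taking `B₁ = B⁺ + A + 1` absorbs the factor
`q ≤ (log x)^A`.

## References

* H. L. Montgomery, R. C. Vaughan, *Multiplicative Number Theory I*, CUP 2007, §11.3, Exercise 8
  (where the Liouville analogue `Λ(x, χ)` of `M(x, χ)` is displayed) and Exercise 13(f).
  [MontgomeryVaughan2007]
* J. D. Lichtman, arXiv:2009.08969, proof of Lemma 4.8 (p. 12). [Lichtman2020]
-/

open Finset ArithmeticFunction
open scoped ArithmeticFunction.Moebius ArithmeticFunction.zeta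

namespace Literature.NumberTheory.LFunctions

namespace SiegelWalfiszLiouville

/-! ### Dirichlet's rearrangement with a coupled condition -/

/-- `∑_{n ≤ N} ∑_{sm = n} F(s, m) = ∑_{s ≤ N} ∑_{m ≤ N/s} F(s, m)` for an arbitrary function of the
pair (Mathlib's `ArithmeticFunction.sum_Ioc_mul_eq_sum_sum` is the case `F(s,m) = f(s)g(m)`). [folklore] -/
theorem sum_Ioc_sum_divisorsAntidiagonal_eq {R : Type*} [AddCommMonoid R] (F : ℕ → ℕ → R) (N : ℕ) :
    ∑ n ∈ Ioc 0 N, ∑ x ∈ n.divisorsAntidiagonal, F x.1 x.2 =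
      ∑ s ∈ Ioc 0 N, ∑ m ∈ Ioc 0 (N / s), F s m := by
  have h1 : ∑ n ∈ Ioc 0 N, ∑ x ∈ n.divisorsAntidiagonal, F x.1 x.2
      = ∑ x ∈ (Ioc 0 N ×ˢ Ioc 0 N).filter (fun x => x.1 * x.2 ≤ N), F x.1 x.2 := by
    trans ∑ n ∈ Ioc 0 N, ∑ x ∈ (Ioc 0 N ×ˢ Ioc 0 N).filter (fun x => x.1 * x.2 = n), F x.1 x.2
    · refine sum_congr rfl fun n hn => ?_
      rw [mem_Ioc] at hn
      rw [Nat.divisorsAntidiagonal_eq_prod_filter_of_le hn.1.ne' hn.2]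
    · simp_rw [sum_filter]
      rw [sum_comm]
      refine sum_congr rfl fun x hx => ?_
      rw [Finset.mem_product, mem_Ioc, mem_Ioc] at hx
      rw [Finset.sum_ite_eq]
      by_cases h : x.1 * x.2 ≤ N
      · rw [if_pos (mem_Ioc.2 ⟨Nat.mul_pos hx.1.1 hx.2.1, h⟩), if_pos h]
      · rw [if_neg (fun hm => h (mem_Ioc.1 hm).2), if_neg h]
  rw [h1, sum_filter, sum_product]
  refine sum_congr rfl fun s hs => ?_
  rw [mem_Ioc] at hs
  rw [← sum_filter]
  congr 1
  ext m
  simp only [mem_filter, mem_Ioc]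
  constructor
  · rintro ⟨⟨hm0, -⟩, hsm⟩
    exact ⟨hm0, (Nat.le_div_iff_mul_le hs.1).2 (by rw [mul_comm]; exact hsm)⟩
  · rintro ⟨hm0, hm⟩
    have h2 : s * m ≤ N := by
      have := (Nat.le_div_iff_mul_le hs.1).1 hm; rw [mul_comm] at this; exact this
    exact ⟨⟨hm0, le_trans (Nat.le_mul_of_pos_left m hs.1) h2⟩, h2⟩

/-- `λ(n) = ∑_{sm = n} 𝟙_□(s) μ(m)` (`λ = 𝟙_□ ⋆ μ`). [folklore] -/
theorem liouville_eq_sum_antidiagonal (n : ℕ) :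
    (liouville n : ℝ) =
      ∑ x ∈ n.divisorsAntidiagonal, (if IsSquare x.1 then (1 : ℝ) else 0) * (μ x.2 : ℝ) := by
  have h := congrArg (fun f : ArithmeticFunction ℝ => f n)
    LiouvilleSum.coe_liouville_eq_zeta_mul_liouville_mul_moebius
  simp only [intCoe_apply] at h
  rw [h, mul_apply]
  refine sum_congr rfl fun x hx => ?_
  have hx1 : x.1 ≠ 0 := by
    rw [Nat.mem_divisorsAntidiagonal] at hx
    exact left_ne_zero_of_mul (hx.1.symm ▸ hx.2)
  rw [LiouvilleSum.zeta_mul_liouville_apply hx1, intCoe_apply]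

/-- **`∑_{n ≤ N, n ≡ a (q)} λ(n) = ∑_{s ≤ N} 𝟙_□(s) ∑_{m ≤ N/s, sm ≡ a (q)} μ(m)`.** [folklore] -/
theorem sum_liouville_progression_eq {q : ℕ} (a : ZMod q) (N : ℕ) :
    ∑ n ∈ (Icc 1 N).filter (fun n : ℕ => (n : ZMod q) = a), (liouville n : ℝ) =
      ∑ s ∈ Ioc 0 N, (if IsSquare s then (1 : ℝ) else 0) *
        ∑ m ∈ (Ioc 0 (N / s)).filter (fun m : ℕ => ((s * m : ℕ) : ZMod q) = a), (μ m : ℝ) := by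
  have hIcc : Icc 1 N = Ioc 0 N := rfl
  rw [hIcc, sum_filter]
  have h1 : ∀ n ∈ Ioc 0 N, (if (n : ZMod q) = a then (liouville n : ℝ) else 0)
      = ∑ x ∈ n.divisorsAntidiagonal,
          (if ((x.1 * x.2 : ℕ) : ZMod q) = a then
            (if IsSquare x.1 then (1 : ℝ) else 0) * (μ x.2 : ℝ) else 0) := by
    intro n hn
    rw [liouville_eq_sum_antidiagonal n]
    split_ifs with h
    · refine sum_congr rfl fun x hx => ?_
      rw [Nat.mem_divisorsAntidiagonal] at hx
      rw [hx.1, if_pos h]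
    · symm
      refine sum_eq_zero fun x hx => ?_
      rw [Nat.mem_divisorsAntidiagonal] at hx
      rw [hx.1, if_neg h]
  rw [sum_congr rfl h1]
  refine (sum_Ioc_sum_divisorsAntidiagonal_eq (fun s m => if ((s * m : ℕ) : ZMod q) = a then
    (if IsSquare s then (1 : ℝ) else 0) * (μ m : ℝ) else 0) N).trans ?_
  refine sum_congr rfl fun s _ => ?_
  rw [sum_filter, mul_sum]
  refine sum_congr rfl fun m _ => ?_
  split_ifs <;> simp

/-! ### Splitting the inner sums by residue classes -/

/-- If every progression sum `|∑_{m ≤ M, m ≡ c (q)} μ(m)|` is at most `B`, then the coupled sum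
`|∑_{m ≤ M, sm ≡ a (q)} μ(m)|` is at most `q B` (at most `q` classes `c` satisfy `sc = a`). [folklore] -/
theorem abs_sum_filter_mul_le {q : ℕ} [NeZero q] (a : ZMod q) (s M : ℕ) {B : ℝ}
    (hB : ∀ c : ZMod q, |∑ m ∈ (Icc 1 M).filter (fun m : ℕ => (m : ZMod q) = c), (μ m : ℝ)| ≤ B) :
    |∑ m ∈ (Ioc 0 M).filter (fun m : ℕ => ((s * m : ℕ) : ZMod q) = a), (μ m : ℝ)| ≤ q * B := by
  have hB0 : 0 ≤ B := (abs_nonneg _).trans (hB 0)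
  set T := (Ioc 0 M).filter (fun m : ℕ => ((s * m : ℕ) : ZMod q) = a) with hT
  rw [← Finset.sum_fiberwise T (fun m : ℕ => (m : ZMod q))]
  refine (abs_sum_le_sum_abs _ _).trans ?_
  have hfib : ∀ c : ZMod q, |∑ m ∈ T.filter (fun m : ℕ => (m : ZMod q) = c), (μ m : ℝ)| ≤ B := by
    intro c
    by_cases hc : (s : ZMod q) * c = a
    · have : T.filter (fun m : ℕ => (m : ZMod q) = c)
          = (Icc 1 M).filter (fun m : ℕ => (m : ZMod q) = c) := by
        ext m
        simp only [hT, mem_filter, mem_Ioc, mem_Icc, Nat.cast_mul]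
        constructor
        · rintro ⟨⟨⟨h0, hM⟩, -⟩, hmc⟩; exact ⟨⟨h0, hM⟩, hmc⟩
        · rintro ⟨⟨h0, hM⟩, hmc⟩; exact ⟨⟨⟨h0, hM⟩, by rw [hmc, hc]⟩, hmc⟩
      rw [this]; exact hB c
    · have : T.filter (fun m : ℕ => (m : ZMod q) = c) = ∅ := by
        rw [Finset.filter_eq_empty_iff]
        intro m hm hmc
        rw [hT, mem_filter, Nat.cast_mul, hmc] at hm
        exact hc hm.2
      rw [this, sum_empty, abs_zero]; exact hB0
  calc ∑ c : ZMod q, |∑ m ∈ T.filter (fun m : ℕ => (m : ZMod q) = c), (μ m : ℝ)|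
      ≤ ∑ _c : ZMod q, B := sum_le_sum fun c _ => hfib c
    _ = q * B := by rw [sum_const, card_univ, ZMod.card, nsmul_eq_mul]

/-- The trivial bound `|∑_{m ≤ M, …} μ(m)| ≤ M`. [folklore] -/
theorem abs_sum_filter_moebius_le (p : ℕ → Prop) [DecidablePred p] (M : ℕ) :
    |∑ m ∈ (Ioc 0 M).filter p, (μ m : ℝ)| ≤ M := by
  calc |∑ m ∈ (Ioc 0 M).filter p, (μ m : ℝ)| ≤ ∑ m ∈ (Ioc 0 M).filter p, |(μ m : ℝ)| :=
        abs_sum_le_sum_abs _ _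
    _ ≤ ∑ _m ∈ (Ioc 0 M).filter p, (1 : ℝ) :=
        sum_le_sum fun m _ => by exact_mod_cast abs_moebius_le_one
    _ ≤ ∑ _m ∈ Ioc 0 M, (1 : ℝ) :=
        sum_le_sum_of_subset_of_nonneg (filter_subset _ _) fun _ _ _ => zero_le_one
    _ = M := by simp

/-! ### Elementary sums -/

/-- `∑_{R < r ≤ S} 1/r² ≤ 1/R` for `R ≥ 1`. [folklore] -/
theorem sum_Ioc_inv_sq_le {R : ℕ} (hR : 1 ≤ R) (S : ℕ) :
    ∑ r ∈ Ioc R S, (1 : ℝ) / (r : ℝ) ^ 2 ≤ 1 / R := by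
  have key : ∀ S : ℕ, R ≤ S → ∑ r ∈ Ioc R S, (1 : ℝ) / (r : ℝ) ^ 2 ≤ 1 / R - 1 / S := by
    intro S hS
    induction S, hS using Nat.le_induction with
    | base => simp
    | succ S hRS ih =>
      rw [Finset.sum_Ioc_succ_top hRS]
      have hS0 : (0 : ℝ) < S := by exact_mod_cast lt_of_lt_of_le hR hRS
      have h1 : (1 : ℝ) / ((S + 1 : ℕ) : ℝ) ^ 2 ≤ 1 / S - 1 / ((S + 1 : ℕ) : ℝ) := by
        push_cast
        rw [div_sub_div _ _ hS0.ne' (by positivity), div_le_div_iff₀ (by positivity) (by positivity)]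
        nlinarith
      linarith
  rcases le_or_gt R S with hRS | hRS
  · have := key S hRS
    have : (0 : ℝ) ≤ 1 / S := by positivity
    linarith
  · rw [Finset.Ioc_eq_empty (by omega), sum_empty]; positivity

/-- `∑_{0 < r ≤ S} 1/r² ≤ 2`. [folklore] -/
theorem sum_Ioc_inv_sq_le_two (S : ℕ) : ∑ r ∈ Ioc 0 S, (1 : ℝ) / (r : ℝ) ^ 2 ≤ 2 := by
  rcases Nat.eq_zero_or_pos S with rfl | hS
  · simp
  · rw [← Finset.sum_Ioc_consecutive (fun r : ℕ => (1 : ℝ) / (r : ℝ) ^ 2) (Nat.zero_le 1) hS]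
    have h1 : ∑ r ∈ Ioc (0 : ℕ) 1, (1 : ℝ) / (r : ℝ) ^ 2 = 1 := by
      rw [show Ioc (0 : ℕ) 1 = {1} by decide]; simp
    have h2 := sum_Ioc_inv_sq_le le_rfl S (R := 1)
    simp only [Nat.cast_one, div_one] at h2
    linarith

/-- The squares of `(0, N]` are the `r²`, `0 < r ≤ √N`. [folklore] -/
theorem filter_isSquare_Ioc_eq_image (N : ℕ) :
    (Ioc 0 N).filter IsSquare = (Ioc 0 (Nat.sqrt N)).image (fun r => r * r) := by
  ext n
  simp only [mem_filter, mem_Ioc, mem_image]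
  constructor
  · rintro ⟨⟨hn0, hnN⟩, r, rfl⟩
    refine ⟨r, ⟨Nat.pos_of_ne_zero ?_, Nat.le_sqrt.mpr hnN⟩, rfl⟩
    rintro rfl; simp at hn0
  · rintro ⟨r, ⟨hr0, hrN⟩, rfl⟩
    exact ⟨⟨Nat.mul_pos hr0 hr0, Nat.le_sqrt.mp hrN⟩, r, rfl⟩

/-- `x^{3/4} ≤ C x/(log x)^B` for `x ≥ 2`. [folklore] -/
theorem exists_rpow_three_quarters_le (B : ℝ) :
    ∃ C : ℝ, 0 ≤ C ∧ ∀ x : ℝ, 2 ≤ x → x ^ (3 / 4 : ℝ) ≤ C * x / Real.log x ^ B := by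
  obtain ⟨C', hC'0, hC'⟩ := exists_mul_exp_neg_sqrt_log_le (1 / 4) (by norm_num) B
  refine ⟨Real.exp (1 / 4) * C', by positivity, fun x hx => ?_⟩
  have hx0 : 0 < x := by linarith
  have hlog0 : 0 ≤ Real.log x := Real.log_nonneg (by linarith)
  -- `x^{3/4} = x exp(-(log x)/4) ≤ e^{1/4} x exp(-√(log x)/4)`
  have h1 : x ^ (3 / 4 : ℝ) = x * Real.exp (-(Real.log x / 4)) := by
    rw [Real.rpow_def_of_pos hx0, show Real.log x * (3 / 4 : ℝ) = Real.log x + -(Real.log x / 4) by ring,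
      Real.exp_add, Real.exp_log hx0]
  have h2 : -(Real.log x / 4) ≤ 1 / 4 + -(1 / 4) * Real.sqrt (Real.log x) := by
    -- `√u ≤ 1 + u` hence `-u/4 ≤ 1/4 - √u/4`
    have hs : Real.sqrt (Real.log x) ≤ 1 + Real.log x := by
      rw [Real.sqrt_le_left (by linarith)]
      nlinarith
    linarith
  calc x ^ (3 / 4 : ℝ) = x * Real.exp (-(Real.log x / 4)) := h1
    _ ≤ x * Real.exp (1 / 4 + -(1 / 4) * Real.sqrt (Real.log x)) := by gcongr
    _ = Real.exp (1 / 4) * (x * Real.exp (-(1 / 4) * Real.sqrt (Real.log x))) := by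
        rw [Real.exp_add]; ring
    _ ≤ Real.exp (1 / 4) * (C' * x / Real.log x ^ B) :=
        mul_le_mul_of_nonneg_left (hC' x hx) (Real.exp_pos _).le
    _ = Real.exp (1 / 4) * C' * x / Real.log x ^ B := by ring

/-- The constant absorbing the bounded range `2 ≤ x ≤ x₁`: `(log x)^B ≤ M(x₁, B)` there. [folklore] -/
noncomputable def smallRangeConst (x₁ B : ℝ) : ℝ :=
  max (max 1 (Real.log (max x₁ 2) ^ B)) (Real.log 2 ^ B)

/-- `(log x)^B ≤ M(x₁, B)` for `2 ≤ x ≤ x₁`. [folklore] -/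
theorem rpow_log_le_smallRangeConst {x x₁ B : ℝ} (hx : 2 ≤ x) (hx₁ : x ≤ x₁) :
    Real.log x ^ B ≤ smallRangeConst x₁ B := by
  have hx0 : 0 < x := by linarith
  have hlog0 : 0 < Real.log x := Real.log_pos (by linarith)
  unfold smallRangeConst
  rcases le_or_gt 0 B with hB | hB
  · rcases le_or_gt 1 (Real.log x) with hl1 | hl1
    · have : Real.log x ^ B ≤ Real.log (max x₁ 2) ^ B :=
        Real.rpow_le_rpow hlog0.le (Real.log_le_log hx0 (hx₁.trans (le_max_left _ _))) hB
      exact this.trans ((le_max_right _ _).trans (le_max_left _ _))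
    · have : Real.log x ^ B ≤ 1 := Real.rpow_le_one hlog0.le hl1.le hB
      exact this.trans ((le_max_left _ _).trans (le_max_left _ _))
  · have : Real.log x ^ B ≤ Real.log 2 ^ B :=
      Real.rpow_le_rpow_of_nonpos (Real.log_pos one_lt_two) (Real.log_le_log two_pos hx) hB.le
    exact this.trans (le_max_right _ _)

/-- In the bounded range a trivial bound `S ≤ x` gives `S ≤ M x/(log x)^B`. [folklore] -/
theorem le_smallRangeConst_mul {S x x₁ B : ℝ} (hx : 2 ≤ x) (hx₁ : x ≤ x₁) (hS : S ≤ x) :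
    S ≤ smallRangeConst x₁ B * x / Real.log x ^ B := by
  have hx0 : 0 < x := by linarith
  have hpow0 : 0 < Real.log x ^ B := Real.rpow_pos_of_pos (Real.log_pos (by linarith)) B
  calc S ≤ x := hS
    _ = Real.log x ^ B * x / Real.log x ^ B := by field_simp
    _ ≤ smallRangeConst x₁ B * x / Real.log x ^ B := by
        rw [div_le_div_iff_of_pos_right hpow0]
        exact mul_le_mul_of_nonneg_right (rpow_log_le_smallRangeConst hx hx₁) hx0.le

/-- `0 ≤ M(x₁, B)`. [folklore] -/
theorem smallRangeConst_nonneg (x₁ B : ℝ) : 0 ≤ smallRangeConst x₁ B :=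
  le_trans zero_le_one ((le_max_left _ _).trans (le_max_left _ _))

/-- The trivial bound `|∑_{n ≤ x, n ≡ a} λ(n)| ≤ x`. [folklore] -/
theorem abs_sum_liouville_progression_le_self {q : ℕ} (a : ZMod q) {x : ℝ} (hx : 0 ≤ x) :
    |∑ n ∈ (Icc 1 ⌊x⌋₊).filter (fun n : ℕ => (n : ZMod q) = a), (liouville n : ℝ)| ≤ x := by
  calc |∑ n ∈ (Icc 1 ⌊x⌋₊).filter (fun n : ℕ => (n : ZMod q) = a), (liouville n : ℝ)|
      ≤ ∑ n ∈ (Icc 1 ⌊x⌋₊).filter (fun n : ℕ => (n : ZMod q) = a), |(liouville n : ℝ)| :=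
        abs_sum_le_sum_abs _ _
    _ ≤ ∑ _n ∈ (Icc 1 ⌊x⌋₊).filter (fun n : ℕ => (n : ZMod q) = a), (1 : ℝ) :=
        sum_le_sum fun n _ => LiouvilleSum.abs_liouville_le_one n
    _ ≤ ∑ _n ∈ Icc 1 ⌊x⌋₊, (1 : ℝ) :=
        sum_le_sum_of_subset_of_nonneg (filter_subset _ _) fun _ _ _ => zero_le_one
    _ = ⌊x⌋₊ := by simp
    _ ≤ x := Nat.floor_le hx

/-- `⌊√⌊√N⌋⌋ ≥ N^{1/4}/2` in the form `N ≤ 2^4 R^4`-free: `(R + 1)^4 > N`. [folklore] -/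
theorem lt_sqrt_sqrt_add_one_pow (N : ℕ) : N < (Nat.sqrt (Nat.sqrt N) + 1) ^ 4 := by
  have h1 := Nat.lt_succ_sqrt N
  have h2 := Nat.lt_succ_sqrt (Nat.sqrt N)
  have h3 : Nat.sqrt N + 1 ≤ (Nat.sqrt (Nat.sqrt N) + 1) ^ 2 := by
    rw [pow_two]; exact h2
  calc N < (Nat.sqrt N + 1) * (Nat.sqrt N + 1) := h1
    _ ≤ (Nat.sqrt (Nat.sqrt N) + 1) ^ 2 * (Nat.sqrt (Nat.sqrt N) + 1) ^ 2 :=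
        Nat.mul_le_mul h3 h3
    _ = (Nat.sqrt (Nat.sqrt N) + 1) ^ 4 := by ring

/-- **The main estimate for large `x`** (`x ≥ e^{16}`): with the Siegel–Walfisz bound for `μ`
(exponents `2A`, `B₁ = B⁺ + A + 1`, constant `C₁ ≥ 0`) and `x^{3/4} ≤ C₂ x/(log x)^B`,
`|∑_{n ≤ x, n ≡ a (q)} λ(n)| ≤ (2·4^{B₁} C₁ + 2C₂) x/(log x)^B` for `1 ≤ q ≤ (log x)^A`. [folklore] -/
theorem abs_sum_liouville_progression_le_of_large {A B C₁ C₂ x : ℝ} (hA : 0 < A) (hC₁ : 0 ≤ C₁)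
    (hSW : ∀ y : ℝ, 2 ≤ y → ∀ q : ℕ, 1 ≤ q → (q : ℝ) ≤ Real.log y ^ (2 * A) → ∀ c : ZMod q,
      |∑ m ∈ (Icc 1 ⌊y⌋₊).filter (fun m : ℕ => (m : ZMod q) = c), (μ m : ℝ)| ≤
        C₁ * y / Real.log y ^ (max B 0 + A + 1))
    (hC₂ : x ^ (3 / 4 : ℝ) ≤ C₂ * x / Real.log x ^ B)
    (hx : Real.exp 16 ≤ x) {q : ℕ} (hq : 1 ≤ q) (hqA : (q : ℝ) ≤ Real.log x ^ A) (a : ZMod q) :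
    |∑ n ∈ (Icc 1 ⌊x⌋₊).filter (fun n : ℕ => (n : ZMod q) = a), (liouville n : ℝ)| ≤
      (2 * 4 ^ (max B 0 + A + 1) * C₁ + 2 * C₂) * x / Real.log x ^ B := by
  haveI : NeZero q := ⟨by omega⟩
  set B₁ := max B 0 + A + 1 with hB₁
  have hB₁0 : 0 ≤ B₁ := by have := le_max_right B 0; positivity
  set L := Real.log x with hL
  have he : (1 : ℝ) ≤ Real.exp 16 := Real.one_le_exp (by norm_num)
  have hx1 : 1 ≤ x := he.trans hx
  have hx0 : 0 < x := by linarith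
  have hL16 : 16 ≤ L := by
    rw [hL, ← Real.log_exp 16]; exact Real.log_le_log (Real.exp_pos _) hx
  have hL0 : 0 < L := by linarith
  have hL1 : 1 ≤ L := by linarith
  set N := ⌊x⌋₊ with hN
  have hNx : (N : ℝ) ≤ x := Nat.floor_le hx0.le
  have hxN : x < N + 1 := Nat.lt_floor_add_one x
  have hx32 : (32 : ℝ) ≤ x := by
    have h2e : (2 : ℝ) ≤ Real.exp 1 := by have := Real.add_one_le_exp (1 : ℝ); linarith
    have : (32 : ℝ) ≤ Real.exp 16 := by
      calc (32 : ℝ) ≤ 2 ^ 16 := by norm_num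
        _ ≤ Real.exp 1 ^ 16 := pow_le_pow_left₀ (by norm_num) h2e 16
        _ = Real.exp 16 := by rw [← Real.exp_nat_mul]; norm_num
    exact this.trans hx
  have hN16 : (16 : ℝ) ≤ N := by linarith
  have hNhalf : x / 2 ≤ N := by linarith
  have hN0 : (0 : ℝ) < N := by linarith
  -- the rearrangement and the squares
  rw [sum_liouville_progression_eq a N]
  set J : ℕ → ℝ := fun s =>
    ∑ m ∈ (Ioc 0 (N / s)).filter (fun m : ℕ => ((s * m : ℕ) : ZMod q) = a), (μ m : ℝ) with hJ
  have hstep1 : |∑ s ∈ Ioc 0 N, (if IsSquare s then (1 : ℝ) else 0) * J s| ≤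
      ∑ r ∈ Ioc 0 (Nat.sqrt N), |J (r * r)| := by
    calc |∑ s ∈ Ioc 0 N, (if IsSquare s then (1 : ℝ) else 0) * J s|
        ≤ ∑ s ∈ Ioc 0 N, |(if IsSquare s then (1 : ℝ) else 0) * J s| := abs_sum_le_sum_abs _ _
      _ = ∑ s ∈ Ioc 0 N, (if IsSquare s then |J s| else 0) := by
          refine sum_congr rfl fun s _ => ?_
          split_ifs <;> simp
      _ = ∑ s ∈ (Ioc 0 N).filter IsSquare, |J s| := (sum_filter _ _).symm
      _ = ∑ r ∈ Ioc 0 (Nat.sqrt N), |J (r * r)| := by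
          rw [filter_isSquare_Ioc_eq_image, sum_image]
          intro r₁ _ r₂ _ h
          exact Nat.mul_self_inj.mp h
  refine hstep1.trans ?_
  -- split at `R = ⌊N^{1/4}⌋`
  set R := Nat.sqrt (Nat.sqrt N) with hR
  have hRS : R ≤ Nat.sqrt N := Nat.sqrt_le_self _
  rw [← Finset.sum_Ioc_consecutive _ (Nat.zero_le R) hRS]
  -- small `r`: Siegel–Walfisz
  have hsmall : ∀ r ∈ Ioc 0 R, |J (r * r)| ≤ C₁ * 4 ^ B₁ / L ^ B * N * (1 / (r : ℝ) ^ 2) := by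
    intro r hr
    rw [mem_Ioc] at hr
    have hr0 : 0 < r := hr.1
    set s := r * r with hs
    have hs0 : 0 < s := Nat.mul_pos hr0 hr0
    have hsle : s ≤ Nat.sqrt N := Nat.le_sqrt.1 hr.2
    -- the real point `y = N/s ≥ √N`
    set y : ℝ := (N : ℝ) / s with hy
    have hs0' : (0 : ℝ) < s := by exact_mod_cast hs0
    have hssN : s * s ≤ N := (Nat.mul_le_mul hsle hsle).trans (Nat.sqrt_le N)
    have hsreal : (s : ℝ) ≤ Real.sqrt N := by
      have h1 : (s : ℝ) * s ≤ N := by exact_mod_cast hssN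
      rw [show (s : ℝ) = Real.sqrt ((s : ℝ) * s) by rw [Real.sqrt_mul_self hs0'.le]]
      exact Real.sqrt_le_sqrt h1
    have hy_ge : Real.sqrt N ≤ y := by
      rw [hy, le_div_iff₀ hs0']
      calc Real.sqrt N * s ≤ Real.sqrt N * Real.sqrt N :=
            mul_le_mul_of_nonneg_left hsreal (Real.sqrt_nonneg _)
        _ = N := Real.mul_self_sqrt hN0.le
    have hsqrt4 : (4 : ℝ) ≤ Real.sqrt N := by
      rw [show (4 : ℝ) = Real.sqrt 16 by rw [show (16:ℝ) = 4 ^ 2 by norm_num, Real.sqrt_sq (by norm_num)]]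
      exact Real.sqrt_le_sqrt hN16
    have hy2 : 2 ≤ y := by linarith
    have hy0 : 0 < y := by linarith
    -- `log y ≥ L/4`
    have hlogy : L / 4 ≤ Real.log y := by
      have h1 : Real.log (Real.sqrt N) ≤ Real.log y := Real.log_le_log (by linarith) hy_ge
      rw [Real.log_sqrt hN0.le] at h1
      have h2 : Real.log (x / 2) ≤ Real.log N := Real.log_le_log (by linarith) hNhalf
      rw [Real.log_div hx0.ne' two_ne_zero] at h2
      have h3 : Real.log 2 ≤ 1 := by
        have := Real.log_le_sub_one_of_pos (by norm_num : (0:ℝ) < 2); linarith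
      have : L / 4 ≤ Real.log N / 2 := by rw [hL]; linarith
      linarith
    have hlogy0 : 0 < Real.log y := by linarith
    -- `q ≤ (log y)^{2A}`
    have hq2A : (q : ℝ) ≤ Real.log y ^ (2 * A) := by
      refine hqA.trans ?_
      have h1 : L ≤ (L / 4) ^ 2 := by nlinarith
      calc L ^ A ≤ ((L / 4) ^ 2) ^ A := Real.rpow_le_rpow hL0.le h1 hA.le
        _ = (L / 4) ^ (2 * A) := by rw [← Real.rpow_natCast, ← Real.rpow_mul (by positivity)]; norm_num
        _ ≤ Real.log y ^ (2 * A) := Real.rpow_le_rpow (by positivity) hlogy (by positivity)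
    -- Siegel–Walfisz at `y`
    have hSWy : ∀ c : ZMod q, |∑ m ∈ (Icc 1 (N / s)).filter (fun m : ℕ => (m : ZMod q) = c),
        (μ m : ℝ)| ≤ C₁ * y / Real.log y ^ B₁ := by
      intro c
      have := hSW y hy2 q hq hq2A c
      rwa [hy, Nat.floor_div_natCast, Nat.floor_natCast] at this
    have hJle := abs_sum_filter_mul_le a s (N / s) hSWy
    refine hJle.trans ?_
    -- numerics: `q · C₁ y/(log y)^{B₁} ≤ C₁ 4^{B₁} L^{-B} N/r²`
    have hpow : (L / 4) ^ B₁ ≤ Real.log y ^ B₁ := Real.rpow_le_rpow (by positivity) hlogy hB₁0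
    have hL4 : 0 < (L / 4) ^ B₁ := Real.rpow_pos_of_pos (by positivity) _
    have e4 : (L / 4) ^ B₁ = L ^ B₁ / 4 ^ B₁ := Real.div_rpow hL0.le (by norm_num) _
    have hLB : L ^ A * L ^ B / L ^ B₁ ≤ 1 := by
      rw [div_le_one (Real.rpow_pos_of_pos hL0 _), ← Real.rpow_add hL0]
      exact Real.rpow_le_rpow_of_exponent_le hL1 (by rw [hB₁]; have := le_max_left B 0; linarith)
    have hyN : y = N * (1 / (r : ℝ) ^ 2) := by
      rw [hy, hs]; push_cast; ring
    calc (q : ℝ) * (C₁ * y / Real.log y ^ B₁) ≤ L ^ A * (C₁ * y / (L / 4) ^ B₁) := by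
          gcongr
      _ = C₁ * 4 ^ B₁ / L ^ B * N * (1 / (r : ℝ) ^ 2) * (L ^ A * L ^ B / L ^ B₁) := by
          rw [e4, hyN]
          field_simp
      _ ≤ C₁ * 4 ^ B₁ / L ^ B * N * (1 / (r : ℝ) ^ 2) * 1 := by
          exact mul_le_mul_of_nonneg_left hLB (by positivity)
      _ = _ := mul_one _
  have hsum_small : ∑ r ∈ Ioc 0 R, |J (r * r)| ≤ 2 * 4 ^ B₁ * C₁ * x / L ^ B := by
    calc ∑ r ∈ Ioc 0 R, |J (r * r)| ≤ ∑ r ∈ Ioc 0 R, C₁ * 4 ^ B₁ / L ^ B * N * (1 / (r : ℝ) ^ 2) :=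
          sum_le_sum hsmall
      _ = C₁ * 4 ^ B₁ / L ^ B * N * ∑ r ∈ Ioc 0 R, (1 / (r : ℝ) ^ 2) := by rw [mul_sum]
      _ ≤ C₁ * 4 ^ B₁ / L ^ B * N * 2 := by
          exact mul_le_mul_of_nonneg_left (sum_Ioc_inv_sq_le_two R) (by positivity)
      _ ≤ C₁ * 4 ^ B₁ / L ^ B * x * 2 := by gcongr
      _ = 2 * 4 ^ B₁ * C₁ * x / L ^ B := by ring
  -- large `r`: trivial bound
  have hR1 : 1 ≤ R := by
    rw [hR, Nat.le_sqrt, Nat.le_sqrt]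
    have : (16 : ℕ) ≤ N := by exact_mod_cast hN16
    omega
  have hlarge : ∀ r ∈ Ioc R (Nat.sqrt N), |J (r * r)| ≤ N * (1 / (r : ℝ) ^ 2) := by
    intro r hr
    rw [mem_Ioc] at hr
    have hr0 : 0 < r := by omega
    refine (abs_sum_filter_moebius_le _ _).trans ?_
    have h1 : ((N / (r * r) : ℕ) : ℝ) ≤ (N : ℝ) / ((r * r : ℕ) : ℝ) := Nat.cast_div_le
    refine h1.trans (le_of_eq ?_)
    push_cast; ring
  have hsum_large : ∑ r ∈ Ioc R (Nat.sqrt N), |J (r * r)| ≤ 2 * C₂ * x / L ^ B := by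
    have h1 : ∑ r ∈ Ioc R (Nat.sqrt N), |J (r * r)| ≤ N * (1 / R) := by
      calc ∑ r ∈ Ioc R (Nat.sqrt N), |J (r * r)| ≤ ∑ r ∈ Ioc R (Nat.sqrt N), N * (1 / (r : ℝ) ^ 2) :=
            sum_le_sum hlarge
        _ = N * ∑ r ∈ Ioc R (Nat.sqrt N), (1 / (r : ℝ) ^ 2) := by rw [mul_sum]
        _ ≤ N * (1 / R) := mul_le_mul_of_nonneg_left (sum_Ioc_inv_sq_le hR1 _) hN0.le
    -- `N/R ≤ 2 N^{3/4} ≤ 2 x^{3/4}`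
    have hR4 : (N : ℝ) < ((R : ℝ) + 1) ^ 4 := by exact_mod_cast lt_sqrt_sqrt_add_one_pow N
    have hR0 : (0 : ℝ) < R := by exact_mod_cast hR1
    have hN34 : (N : ℝ) * (1 / R) ≤ 2 * x ^ (3 / 4 : ℝ) := by
      -- `N^{1/4} < R + 1 ≤ 2R`, so `N/R ≤ 2 N^{3/4} ≤ 2 x^{3/4}`
      have hq4 : (N : ℝ) ^ (1 / 4 : ℝ) < R + 1 := by
        have : ((N : ℝ) ^ (1 / 4 : ℝ)) ^ (4 : ℕ) = N := by
          rw [← Real.rpow_natCast, ← Real.rpow_mul hN0.le]; norm_num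
        by_contra hcon
        push Not at hcon
        have : ((R : ℝ) + 1) ^ 4 ≤ ((N : ℝ) ^ (1 / 4 : ℝ)) ^ 4 := by gcongr
        linarith
      have hR1' : (1 : ℝ) ≤ R := by exact_mod_cast hR1
      have hR2 : (N : ℝ) ^ (1 / 4 : ℝ) ≤ 2 * R := by linarith
      have hN14 : 0 < (N : ℝ) ^ (1 / 4 : ℝ) := Real.rpow_pos_of_pos hN0 _
      have e : (N : ℝ) = (N : ℝ) ^ (1 / 4 : ℝ) * (N : ℝ) ^ (3 / 4 : ℝ) := by
        rw [← Real.rpow_add hN0]; norm_num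
      have hx34 : (N : ℝ) ^ (3 / 4 : ℝ) ≤ x ^ (3 / 4 : ℝ) := Real.rpow_le_rpow hN0.le hNx (by norm_num)
      calc (N : ℝ) * (1 / R) = (N : ℝ) ^ (1 / 4 : ℝ) * (N : ℝ) ^ (3 / 4 : ℝ) * (1 / R) := by rw [← e]
        _ = (N : ℝ) ^ (1 / 4 : ℝ) / R * (N : ℝ) ^ (3 / 4 : ℝ) := by ring
        _ ≤ 2 * (N : ℝ) ^ (3 / 4 : ℝ) := by
            refine mul_le_mul_of_nonneg_right ?_ (Real.rpow_nonneg hN0.le _)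
            rw [div_le_iff₀ hR0]; exact hR2
        _ ≤ 2 * x ^ (3 / 4 : ℝ) := by linarith
    calc ∑ r ∈ Ioc R (Nat.sqrt N), |J (r * r)| ≤ N * (1 / R) := h1
      _ ≤ 2 * x ^ (3 / 4 : ℝ) := hN34
      _ ≤ 2 * (C₂ * x / L ^ B) := by linarith
      _ = 2 * C₂ * x / L ^ B := by ring
  calc ∑ r ∈ Ioc 0 R, |J (r * r)| + ∑ r ∈ Ioc R (Nat.sqrt N), |J (r * r)|
      ≤ 2 * 4 ^ B₁ * C₁ * x / L ^ B + 2 * C₂ * x / L ^ B := add_le_add hsum_small hsum_large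
    _ = (2 * 4 ^ B₁ * C₁ + 2 * C₂) * x / L ^ B := by ring

end SiegelWalfiszLiouville

open SiegelWalfiszLiouville in
/-- **Siegel–Walfisz for the Liouville function in arithmetic progressions**, in the `(log x)^{-B}`
currency: for every `A > 0` and real `B` there is `C` with
`|∑_{n ≤ x, n ≡ a (q)} λ(n)| ≤ C x/(log x)^B` for all `x ≥ 2`, `1 ≤ q ≤ (log x)^A` and every
residue `a (mod q)`.  PROVED from the named fact `SiegelWalfiszMoebius` (the Möbius version,
Montgomery–Vaughan §11.3 Exercise 13(f)) through `λ = 𝟙_□ ⋆ μ`. [cite: MontgomeryVaughan2007, §11.3 Exercises 8 and 13(f), pp. 383–384] -/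
theorem SiegelWalfiszMoebius.liouville_progression (h : SiegelWalfiszMoebius) {A : ℝ} (hA : 0 < A)
    (B : ℝ) :
    ∃ C : ℝ, ∀ x : ℝ, 2 ≤ x → ∀ q : ℕ, 1 ≤ q → (q : ℝ) ≤ Real.log x ^ A → ∀ a : ZMod q,
      |∑ n ∈ (Icc 1 ⌊x⌋₊).filter (fun n : ℕ => (n : ZMod q) = a), (liouville n : ℝ)| ≤
        C * x / Real.log x ^ B := by
  obtain ⟨C₁, hC₁⟩ := h.logPow (A := 2 * A) (by positivity) (max B 0 + A + 1)
  obtain ⟨C₂, hC₂0, hC₂⟩ := exists_rpow_three_quarters_le B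
  -- `C₁ ≥ 0` without loss
  have hSW : ∀ y : ℝ, 2 ≤ y → ∀ q : ℕ, 1 ≤ q → (q : ℝ) ≤ Real.log y ^ (2 * A) → ∀ c : ZMod q,
      |∑ m ∈ (Icc 1 ⌊y⌋₊).filter (fun m : ℕ => (m : ZMod q) = c), (μ m : ℝ)| ≤
        max C₁ 0 * y / Real.log y ^ (max B 0 + A + 1) := by
    intro y hy q hq hqA c
    refine (hC₁ y hy q hq hqA c).trans ?_
    have hpow : 0 < Real.log y ^ (max B 0 + A + 1) := Real.rpow_pos_of_pos (Real.log_pos (by linarith)) _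
    rw [div_le_div_iff_of_pos_right hpow]
    exact mul_le_mul_of_nonneg_right (le_max_left _ _) (by linarith)
  set K := 2 * 4 ^ (max B 0 + A + 1) * max C₁ 0 + 2 * C₂ with hK
  have hK0 : 0 ≤ K := by positivity
  refine ⟨max K (smallRangeConst (Real.exp 16) B), fun x hx q hq hqA a => ?_⟩
  have hx0 : 0 < x := by linarith
  have hpow : 0 < Real.log x ^ B := Real.rpow_pos_of_pos (Real.log_pos (by linarith)) B
  rcases le_or_gt (Real.exp 16) x with hx16 | hx16
  · refine (abs_sum_liouville_progression_le_of_large hA (le_max_right _ _) hSW (hC₂ x hx) hx16 hq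
      hqA a).trans ?_
    rw [div_le_div_iff_of_pos_right hpow]
    exact mul_le_mul_of_nonneg_right (le_max_left _ _) hx0.le
  · refine (le_smallRangeConst_mul hx hx16.le (abs_sum_liouville_progression_le_self a hx0.le)
      (B := B)).trans ?_
    rw [div_le_div_iff_of_pos_right hpow]
    exact mul_le_mul_of_nonneg_right (le_max_right _ _) hx0.le

end Literature.NumberTheory.LFunctions
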